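import Literature.Computability.FineGrained.SchoeningCoinBound
import HarnessLib

/-!
# A biased-start Schöning walk for 4-SAT as a coin-string function, I: the algorithm

Topic `Literature/Computability/FineGrained`; first file of the line `SchoeningFour*` (sub-namespace
`SchoeningFour`) towards the discharge of the named fact
`Literature.Computability.FineGrained.randSatExponent_four_lt_schoening` (`SatAlgorithms.lean`:
`σ₄ < log₂ (3/2)`, i.e. bounded-error randomized 4-SAT strictly faster than Schöning's
`(3/2)ⁿ · poly(L)`; Paturi–Pudlák–Saks–Zane, J. ACM 52 (2005), Theorem 3 give `1.476ⁿ` by the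
PPSZ algorithm). The formal discharge does **not** follow PPSZ: it formalises the cheaper idea of
Hofmeister–Schöning–Schuler–Watanabe (STACS 2002, §3, there for 3-SAT) of starting Schöning's
random walk (`SchoeningCoinAlgorithm.lean`, `SchoeningCoinBound.lean`: the line `SchoeningCoin*`,
which this line extends and reuses throughout) from a *biased* random assignment on a maximal
family of variable-disjoint clauses of width exactly `4`, combined — when that family is small —
with a walk that never touches the family's variables (a 3-SAT walk in disguise). This gives
4-SAT in bounded-error time `2^{δ n} · poly(L)` with
`δ = log₂ (3/2) - log₂ (259/256) / 16 < log₂ (3/2)`, which is all the named fact asks for.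

This file is machine-free. It defines the algorithm as a function of the coin string — exactly the
function computed by the stack machine of the files `SchoeningFour{Routines,Dedup,Select,Init,Step,
Machine}.lean` — and proves its bookkeeping properties: deduplication of clauses (`dedup`), the
greedy family (`hAfter`, `selC`) and its maximality (`exists_memV_of_length_eq_four`), the biased
table (`tbl`), the two initialisation passes (`initSel`, `initCond`), the frozen walk (`stepF`,
`walkF`), one ticket (`ticket`: biased initialisation, Schöning's walk, and on failure the frozen
walk from the same initial assignment) and the whole algorithm (`run4`), the exact coin consumption
of a failing ticket (`ticket_append`) and the one-sided error (`run4_eq_false_of_not_satisfiable`).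

## The algorithm

* `dedup φ`: in every clause keep one literal per variable (the first occurrence), and drop the
  clause altogether if a variable occurs in it with both polarities; `eval` is unchanged
  (`eval_dedup`) and afterwards the variables of a clause are pairwise distinct (`nodup_of_mem_dedup`).
* Greedy family: reading the clauses in order, a clause is *selected* (`selC`) iff it has exactly
  `4` literals and none of its variables was selected before; `hAfter cs []` is the literal list of
  the selected variables (the register `acc` of the machine). Every clause of width `4` meets it
  (`exists_memV_of_length_eq_four`).
* `initSel`: for each selected clause read `10` coins as `u < 1024` and give its four literals the
  truth values `tbl u` (a pattern of Hamming weight `1, 2, 3, 4` with multiplicity `86, 58, 67, 64`;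
  never all-false); `initCond`: then every occurrence of a still unassigned variable takes one coin.
* `ticket`: `initSel`, `initCond`, then Schöning's walk `SchoeningCoin.walk φ 3 S` (`S = sOf φ`);
  if it fails, the frozen walk `walkF` of `S` steps from the *same* initial assignment: first
  violated clause, `3` coins as `u < 8`, flip the variable of the `u`-th literal among those not on
  selected variables (nothing if there is none). `run4`: one ticket per remaining coin until the
  coins are exhausted.

## References

* T. Hofmeister, U. Schöning, R. Schuler, O. Watanabe, *A probabilistic 3-SAT algorithm further
  improved*, STACS 2002, LNCS 2285, 192–202, doi:10.1007/3-540-45841-7_15, §2 (maximal independent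
  clause sets), §3 (biased initial assignments on independent clauses; the programme followed here,
  transposed from 3-clauses to 4-clauses) [key `HofmeisterEtAl2002`; held, read 2026-08-15].
* U. Schöning, *A probabilistic algorithm for k-SAT and constraint satisfaction problems*, Proc.
  40th FOCS (1999) 410–414, Theorem (the walk) [key `SchoeningFOCS1999`].
* R. Paturi, P. Pudlák, M. E. Saks, F. Zane, *An improved exponential-time algorithm for k-SAT*,
  J. ACM 52 (2005) 337–364, Theorem 3 (the statement being discharged, with a weaker constant)
  [key `PaturiPudlakSaksZane2005`].
-/

namespace Literature.Computability.FineGrained.SchoeningFour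

open _root_.Computability Complexity SchoeningCoin

variable {k : ℕ}

/-! ### Membership of a variable in a literal list -/

/-- `memV L x`: the literal list `L` has an entry on the variable `x` (the *found* flag of a lookup).
[folklore] -/
def memV (L : Asg) (x : ℕ) : Bool := L.any fun m => m.1 == x

/-- `memV` on nil. [folklore] -/
@[simp] theorem memV_nil (x : ℕ) : memV [] x = false := rfl

/-- `memV` on a cons. [folklore] -/
@[simp] theorem memV_cons (m : ℕ × Bool) (L : Asg) (x : ℕ) : memV (m :: L) x = (m.1 == x || memV L x) := by
  simp [memV]

/-- `memV` on an append. [folklore] -/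
@[simp] theorem memV_append (L₁ L₂ : Asg) (x : ℕ) : memV (L₁ ++ L₂) x = (memV L₁ x || memV L₂ x) := by
  simp [memV]

/-- `memV` is membership of the variable among the first components. [folklore] -/
theorem memV_eq_true_iff (L : Asg) (x : ℕ) : memV L x = true ↔ x ∈ L.map Prod.fst := by
  unfold memV
  rw [List.any_eq_true, List.mem_map]
  constructor
  · rintro ⟨m, hm, h⟩; exact ⟨m, hm, by simpa using h⟩
  · rintro ⟨m, hm, h⟩; exact ⟨m, hm, by simpa using h⟩

/-- `memV` as the success of `find?`. [folklore] -/
theorem memV_eq_isSome_find (L : Asg) (x : ℕ) : memV L x = (L.find? fun m => m.1 == x).isSome := by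
  unfold memV
  induction L with
  | nil => rfl
  | cons m L ih =>
    rw [List.any_cons, List.find?_cons]
    by_cases h : (m.1 == x) = true
    · simp [h]
    · simp only [Bool.not_eq_true] at h; simp [h, ih]

/-- Without an entry on `x`, the value read is `false`. [folklore] -/
theorem val_of_memV_false {L : Asg} {x : ℕ} (h : memV L x = false) : L.val x = false := by
  unfold Asg.val
  rw [memV_eq_isSome_find] at h
  cases hf : L.find? (fun m => m.1 == x) with
  | none => rfl
  | some m => rw [hf] at h; simp at h

/-! ### Deduplication of clauses -/

/-- Deduplicate the literals of a clause against the accumulator `acc` (one entry per variable, most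
recent first): a literal on a new variable is pushed, a repeated literal dropped, and a literal
complementary to an earlier one makes the clause a tautology (`none`). [folklore] -/
def dedupC : List (ℕ × Bool) → Asg → Option Asg
  | [], acc => some acc
  | l :: c, acc =>
    match acc.find? (fun m => m.1 == l.1) with
    | none => dedupC c (l :: acc)
    | some m => if m.2 = l.2 then dedupC c acc else none

/-- The kept literals come from the clause or the accumulator. [folklore] -/
theorem mem_of_dedupC : ∀ {c : List (ℕ × Bool)} {acc D : Asg}, dedupC c acc = some D →
    ∀ l ∈ D, l ∈ c ∨ l ∈ acc
  | [], acc, D, h, l, hl => by simp [dedupC] at h; subst h; exact Or.inr hl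
  | l' :: c, acc, D, h, l, hl => by
    unfold dedupC at h
    split at h
    · rcases mem_of_dedupC h l hl with h1 | h1
      · exact Or.inl (List.mem_cons_of_mem _ h1)
      · rcases List.mem_cons.1 h1 with rfl | h2
        · exact Or.inl List.mem_cons_self
        · exact Or.inr h2
    · split_ifs at h
      rcases mem_of_dedupC h l hl with h1 | h1
      · exact Or.inl (List.mem_cons_of_mem _ h1)
      · exact Or.inr h1

/-- The kept literals are at most as many as the clause and the accumulator together. [folklore] -/
theorem length_dedupC_le : ∀ {c : List (ℕ × Bool)} {acc D : Asg}, dedupC c acc = some D →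
    D.length ≤ c.length + acc.length
  | [], acc, D, h => by simp [dedupC] at h; subst h; simp
  | l :: c, acc, D, h => by
    unfold dedupC at h
    split at h
    · have := length_dedupC_le h; simp at this ⊢; omega
    · split_ifs at h
      have := length_dedupC_le h; simp at this ⊢; omega

/-- The kept literals have pairwise distinct variables. [folklore] -/
theorem nodup_dedupC : ∀ {c : List (ℕ × Bool)} {acc D : Asg}, (acc.map Prod.fst).Nodup →
    dedupC c acc = some D → (D.map Prod.fst).Nodup
  | [], acc, D, hn, h => by simp [dedupC] at h; subst h; exact hn
  | l :: c, acc, D, hn, h => by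
    unfold dedupC at h
    split at h
    · next hf =>
      refine nodup_dedupC ?_ h
      rw [List.map_cons, List.nodup_cons]
      refine ⟨fun hx => ?_, hn⟩
      obtain ⟨m, hm, hmx⟩ := List.mem_map.1 hx
      have := List.find?_eq_none.1 hf m hm
      simp [hmx] at this
    · split_ifs at h
      exact nodup_dedupC hn h

/-- Deduplication keeps the truth value: the kept literals, or-ed, are the clause or-ed with the
accumulator. [folklore] -/
theorem any_dedupC (v : ℕ → Bool) : ∀ {c : List (ℕ × Bool)} {acc D : Asg}, dedupC c acc = some D →
    D.any (fun l => v l.1 == l.2) = (c.any (fun l => v l.1 == l.2) || acc.any (fun l => v l.1 == l.2))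
  | [], acc, D, h => by simp [dedupC] at h; subst h; simp
  | l :: c, acc, D, h => by
    unfold dedupC at h
    split at h
    · rw [any_dedupC v h, List.any_cons, List.any_cons]
      cases (v l.1 == l.2) <;> simp [Bool.or_comm]
    · next m hf =>
      split_ifs at h with hm
      rw [any_dedupC v h, List.any_cons]
      have hm1 : m.1 = l.1 := by simpa using List.find?_some hf
      have hmacc : m ∈ acc := List.mem_of_find?_eq_some hf
      cases hvl : (v l.1 == l.2)
      · simp
      · have : acc.any (fun l => v l.1 == l.2) = true :=
          List.any_eq_true.2 ⟨m, hmacc, by rw [hm1, hm]; exact hvl⟩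
        simp [this]

/-- A clause dropped by deduplication is a tautology: together with the accumulator it contains a
variable with both polarities, so it is satisfied by every assignment. [folklore] -/
theorem any_of_dedupC_eq_none (v : ℕ → Bool) : ∀ {c : List (ℕ × Bool)} {acc : Asg}, dedupC c acc = none →
    (c.any (fun l => v l.1 == l.2) || acc.any (fun l => v l.1 == l.2)) = true
  | [], acc, h => by simp [dedupC] at h
  | l :: c, acc, h => by
    unfold dedupC at h
    split at h
    · have := any_of_dedupC_eq_none v h
      rw [List.any_cons] at this
      rw [List.any_cons]
      revert this
      cases (v l.1 == l.2) <;> cases c.any (fun l => v l.1 == l.2) <;> cases acc.any (fun l => v l.1 == l.2) <;> simp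
    · next m hf =>
      split_ifs at h with hm
      · have := any_of_dedupC_eq_none v h
        rw [List.any_cons]
        revert this
        cases (v l.1 == l.2) <;> cases c.any (fun l => v l.1 == l.2) <;> cases acc.any (fun l => v l.1 == l.2) <;> simp
      · have hm1 : m.1 = l.1 := by simpa using List.find?_some hf
        have hmacc : m ∈ acc := List.mem_of_find?_eq_some hf
        rw [List.any_cons]
        cases hvl : v l.1
        · -- `l` false means `m` (opposite polarity) is true, or conversely
          cases hl2 : l.2
          · simp
          · have hm2 : m.2 = false := by
              cases h2 : m.2
              · rfl
              · exact absurd (h2.trans hl2.symm) hm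
            have : acc.any (fun l => v l.1 == l.2) = true :=
              List.any_eq_true.2 ⟨m, hmacc, by rw [hm1, hvl, hm2]; rfl⟩
            simp [this]
        · cases hl2 : l.2
          · have hm2 : m.2 = true := by
              cases h2 : m.2
              · exact absurd (h2.trans hl2.symm) hm
              · rfl
            have : acc.any (fun l => v l.1 == l.2) = true :=
              List.any_eq_true.2 ⟨m, hmacc, by rw [hm1, hvl, hm2]; rfl⟩
            simp [this]
          · simp

/-- **Deduplication of a `k`-CNF**: every clause deduplicated from the empty accumulator, tautologies
dropped. [folklore] -/
def dedup (φ : KCNF k) : KCNF k where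
  numVars := φ.numVars
  clauses := φ.clauses.filterMap fun c => dedupC c []
  fst_lt_numVars := by
    intro D hD l hl
    obtain ⟨c, hc, hcD⟩ := List.mem_filterMap.1 hD
    rcases mem_of_dedupC hcD l hl with h | h
    · exact φ.fst_lt_numVars c hc l h
    · simp at h
  length_le := by
    intro D hD
    obtain ⟨c, hc, hcD⟩ := List.mem_filterMap.1 hD
    have := length_dedupC_le hcD
    simp only [List.length_nil, Nat.add_zero] at this
    exact this.trans (φ.length_le c hc)

/-- `dedup` keeps the number of variables. [folklore] -/
@[simp] theorem numVars_dedup (φ : KCNF k) : (dedup φ).numVars = φ.numVars := rfl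

/-- The clauses of `dedup φ`. [folklore] -/
theorem clauses_dedup (φ : KCNF k) : (dedup φ).clauses = φ.clauses.filterMap fun c => dedupC c [] := rfl

/-- **`dedup` keeps the truth value under every assignment.** [folklore] -/
theorem eval_dedup (φ : KCNF k) (v : ℕ → Bool) : (dedup φ).eval v = φ.eval v := by
  unfold KCNF.eval
  rw [clauses_dedup]
  induction φ.clauses with
  | nil => rfl
  | cons c cs ih =>
    rw [List.filterMap_cons]
    cases h : dedupC c [] with
    | none =>
      have := any_of_dedupC_eq_none v h
      simp only [List.any_nil, Bool.or_false] at this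
      simp only [List.all_cons, this, Bool.true_and]
      exact ih
    | some D =>
      have := any_dedupC v h
      simp only [List.any_nil, Bool.or_false] at this
      simp only [List.all_cons, this]
      rw [ih]

/-- `dedup` keeps satisfiability. [folklore] -/
theorem satisfiable_dedup_iff (φ : KCNF k) : (dedup φ).Satisfiable ↔ φ.Satisfiable := by
  unfold KCNF.Satisfiable
  simp only [numVars_dedup, eval_dedup]

/-- **After deduplication the variables of a clause are pairwise distinct.** [folklore] -/
theorem nodup_of_mem_dedup (φ : KCNF k) {C : List (ℕ × Bool)} (hC : C ∈ (dedup φ).clauses) :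
    (C.map Prod.fst).Nodup := by
  rw [clauses_dedup] at hC
  obtain ⟨c, _, hcD⟩ := List.mem_filterMap.1 hC
  exact nodup_dedupC (by simp) hcD

/-! ### The greedy family of variable-disjoint clauses of width `4` -/

/-- A clause is *selected* against the literal list `Hl` of the variables selected so far: it has
exactly `4` literals and none of its variables is selected. [cite: HofmeisterEtAl2002, §2 (a maximal set of independent clauses, found greedily)] -/
def selC (Hl : Asg) (C : List (ℕ × Bool)) : Bool := (C.length == 4) && C.all fun l => !memV Hl l.1

/-- Record the variables of a selected clause (entries `(x, false)`, in order, on top of `Hl`).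
[folklore] -/
def pushH : List (ℕ × Bool) → Asg → Asg
  | [], Hl => Hl
  | l :: C, Hl => pushH C ((l.1, false) :: Hl)

/-- The selected variables after reading the clauses `cs` from the selection state `Hl`. [cite: HofmeisterEtAl2002, §2] -/
def hAfter : List (List (ℕ × Bool)) → Asg → Asg
  | [], Hl => Hl
  | C :: cs, Hl => hAfter cs (if selC Hl C then pushH C Hl else Hl)

/-- `hAfter` over an append. [folklore] -/
theorem hAfter_append : ∀ (cs₁ cs₂ : List (List (ℕ × Bool))) (Hl : Asg),
    hAfter (cs₁ ++ cs₂) Hl = hAfter cs₂ (hAfter cs₁ Hl)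
  | [], cs₂, Hl => rfl
  | C :: cs₁, cs₂, Hl => by rw [List.cons_append, hAfter, hAfter, hAfter_append cs₁ cs₂]

/-- `pushH` adds exactly the variables of the clause. [folklore] -/
theorem memV_pushH : ∀ (C : List (ℕ × Bool)) (Hl : Asg) (x : ℕ),
    memV (pushH C Hl) x = (memV Hl x || C.any fun l => l.1 == x)
  | [], Hl, x => by simp [pushH]
  | l :: C, Hl, x => by
    rw [pushH, memV_pushH C, memV_cons, List.any_cons]
    cases (l.1 == x) <;> cases memV Hl x <;> simp

/-- `pushH` as an explicit list. [folklore] -/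
theorem pushH_eq : ∀ (C : List (ℕ × Bool)) (Hl : Asg), pushH C Hl = (C.map fun l => (l.1, false)).reverse ++ Hl
  | [], Hl => by simp [pushH]
  | l :: C, Hl => by rw [pushH, pushH_eq C]; simp

/-- `hAfter` only adds variables. [folklore] -/
theorem memV_hAfter_of_memV : ∀ (cs : List (List (ℕ × Bool))) {Hl : Asg} {x : ℕ}, memV Hl x = true →
    memV (hAfter cs Hl) x = true
  | [], Hl, x, h => h
  | C :: cs, Hl, x, h => by
    rw [hAfter]
    refine memV_hAfter_of_memV cs ?_
    split_ifs
    · rw [memV_pushH, h, Bool.true_or]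
    · exact h

/-- **Maximality of the greedy family**: every clause of width `4` among `cs` has a variable selected
by `hAfter cs Hl`. [cite: HofmeisterEtAl2002, §2 ("every clause shares a variable with an independent clause")] -/
theorem exists_memV_of_length_eq_four : ∀ (cs : List (List (ℕ × Bool))) (Hl : Asg) {C : List (ℕ × Bool)},
    C ∈ cs → C.length = 4 → ∃ l ∈ C, memV (hAfter cs Hl) l.1 = true
  | [], Hl, C, hC, _ => by simp at hC
  | C' :: cs, Hl, C, hC, hlen => by
    rw [hAfter]
    rcases List.mem_cons.1 hC with rfl | hC
    · by_cases hs : selC Hl C = true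
      · rw [if_pos hs]
        obtain ⟨l, C₀, rfl⟩ : ∃ l C₀, C = l :: C₀ := by
          cases C with
          | nil => simp at hlen
          | cons l C₀ => exact ⟨l, C₀, rfl⟩
        refine ⟨l, List.mem_cons_self, memV_hAfter_of_memV cs ?_⟩
        rw [memV_pushH]
        simp
      · rw [if_neg hs]
        have : ∃ l ∈ C, memV Hl l.1 = true := by
          unfold selC at hs
          rw [hlen] at hs
          simp only [beq_self_eq_true, Bool.true_and, List.all_eq_true, Bool.not_eq_true', not_forall,
            Bool.not_eq_false, exists_prop] at hs
          exact hs
        obtain ⟨l, hl, hm⟩ := this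
        exact ⟨l, hl, memV_hAfter_of_memV cs hm⟩
    · by_cases hs : selC Hl C' = true
      · rw [if_pos hs]; exact exists_memV_of_length_eq_four cs _ hC hlen
      · rw [if_neg hs]; exact exists_memV_of_length_eq_four cs _ hC hlen

/-! ### The biased table -/

/-- The patterns of Hamming weight `1`. [folklore] -/
def pats1 : List (List Bool) :=
  [[true, false, false, false], [false, true, false, false], [false, false, true, false], [false, false, false, true]]

/-- The patterns of Hamming weight `2`. [folklore] -/
def pats2 : List (List Bool) :=
  [[true, true, false, false], [true, false, true, false], [true, false, false, true],
   [false, true, true, false], [false, true, false, true], [false, false, true, true]]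

/-- The patterns of Hamming weight `3`. [folklore] -/
def pats3 : List (List Bool) :=
  [[false, true, true, true], [true, false, true, true], [true, true, false, true], [true, true, true, false]]

/-- The pattern of Hamming weight `4`. [folklore] -/
def pats4 : List (List Bool) := [[true, true, true, true]]

/-- **The biased table**: `1024` patterns of truth values for the four literals of a selected clause,
each pattern of weight `1, 2, 3, 4` repeated `86, 58, 67, 64` times (a dyadic rounding of the
optimal start distribution of a 4-clause, which has weights proportional to `27, 18, 21, 20` per
pattern; the all-false pattern, which cannot be the restriction of a satisfying assignment, gets
probability `0`). [cite: HofmeisterEtAl2002, §3 (the biased distribution `(p₁, p₂, p₃)` on the literals of an independent 3-clause; here its 4-clause analogue)] -/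
def tblList : List (List Bool) :=
  pats1.flatMap (fun p => List.replicate 86 p) ++ pats2.flatMap (fun p => List.replicate 58 p) ++
    pats3.flatMap (fun p => List.replicate 67 p) ++ pats4.flatMap (fun p => List.replicate 64 p)

/-- The table has `1024 = 2^10` entries. [folklore] -/
theorem length_tblList : tblList.length = 1024 := by
  simp only [tblList, pats1, pats2, pats3, pats4, List.length_append, List.length_flatMap, List.length_replicate,
    List.map_cons, List.map_nil, List.sum_cons, List.sum_nil, Nat.reduceAdd]

/-- The pattern read with the number `u` (`u < 1024`; the default is never used). [folklore] -/
def tbl (u : ℕ) : List Bool := tblList.getD u [true, true, true, true]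

/-- Every entry of the table is a pattern of length `4`. [folklore] -/
theorem length_of_mem_tblList {p : List Bool} (hp : p ∈ tblList) : p.length = 4 := by
  simp only [tblList, List.mem_append, List.mem_flatMap, List.mem_replicate] at hp
  rcases hp with ((⟨q, hq, _, rfl⟩ | ⟨q, hq, _, rfl⟩) | ⟨q, hq, _, rfl⟩) | ⟨q, hq, _, rfl⟩
  · simp only [pats1, List.mem_cons, List.not_mem_nil, or_false] at hq
    rcases hq with rfl | rfl | rfl | rfl <;> rfl
  · simp only [pats2, List.mem_cons, List.not_mem_nil, or_false] at hq
    rcases hq with rfl | rfl | rfl | rfl | rfl | rfl <;> rfl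
  · simp only [pats3, List.mem_cons, List.not_mem_nil, or_false] at hq
    rcases hq with rfl | rfl | rfl | rfl <;> rfl
  · simp only [pats4, List.mem_cons, List.not_mem_nil, or_false] at hq
    subst hq; rfl

/-- `tbl u` has length `4`. [folklore] -/
theorem length_tbl (u : ℕ) : (tbl u).length = 4 := by
  unfold tbl
  rw [List.getD_eq_getElem?_getD]
  cases h : tblList[u]? with
  | none => rfl
  | some p => exact length_of_mem_tblList (List.mem_of_getElem? h)

/-! ### The biased initialisation of the selected clauses -/

/-- The value given to the variable of a literal of polarity `s` so that the literal gets the truth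
value `b`. [folklore] -/
def litVal (s b : Bool) : Bool := if b then s else !s

/-- A literal of polarity `s` on a variable of value `litVal s b` has truth value `b`. [folklore] -/
@[simp] theorem litVal_beq (s b : Bool) : (litVal s b == s) = b := by
  cases s <;> cases b <;> rfl

/-- Lay the literals of a selected clause with the truth values of a pattern (in order, so the last
literal ends on top). [cite: HofmeisterEtAl2002, §3 (procedure Ind-Clauses-Assign)] -/
def pushSel : List (ℕ × Bool) → List Bool → Asg → Asg
  | l :: C, b :: p, L => pushSel C p ((l.1, litVal l.2 b) :: L)
  | _, _, L => L

/-- `pushSel` as an explicit list (pattern long enough). [folklore] -/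
theorem pushSel_eq : ∀ (C : List (ℕ × Bool)) (p : List Bool) (L : Asg), C.length ≤ p.length →
    pushSel C p L = ((C.zip p).map fun q => (q.1.1, litVal q.1.2 q.2)).reverse ++ L
  | [], p, L, _ => by cases p <;> simp [pushSel]
  | l :: C, [], L, h => by simp at h
  | l :: C, b :: p, L, h => by
    rw [pushSel, pushSel_eq C p _ (by simpa using h)]
    simp

/-- `pushSel` adds exactly the variables of the clause (pattern long enough). [folklore] -/
theorem memV_pushSel (C : List (ℕ × Bool)) (p : List Bool) (L : Asg) (h : C.length ≤ p.length) (x : ℕ) :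
    memV (pushSel C p L) x = (memV L x || C.any fun l => l.1 == x) := by
  rw [pushSel_eq C p L h, memV_append, Bool.or_comm]
  congr 1
  rw [Bool.eq_iff_iff, memV_eq_true_iff, List.any_eq_true]
  simp only [List.map_reverse, List.mem_reverse, List.map_map, List.mem_map, Function.comp]
  constructor
  · rintro ⟨q, hq, rfl⟩
    exact ⟨q.1, (List.of_mem_zip hq).1, by simp⟩
  · rintro ⟨l, hl, hlx⟩
    obtain ⟨i, hi, rfl⟩ := List.getElem_of_mem hl
    have hip : i < p.length := by omega
    refine ⟨(C[i], p[i]), ?_, by simpa using hlx⟩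
    have : (C.zip p)[i]'(by rw [List.length_zip]; omega) = (C[i], p[i]) := List.getElem_zip
    rw [← this]
    exact List.getElem_mem _

/-- The selection state: the selected variables `Hl`, the assignment `L`, the unread coins. One
clause of the selection pass: a selected clause reads `10` coins and lays its four literals with the
truth values of the table pattern. [cite: HofmeisterEtAl2002, §3] -/
def selClause (C : List (ℕ × Bool)) (σ : Asg × Asg × List Bool) : Asg × Asg × List Bool :=
  if selC σ.1 C then (pushH C σ.1, pushSel C (tbl (readU 10 σ.2.2).1) σ.2.1, (readU 10 σ.2.2).2) else σ

/-- **The selection pass** over the clauses. [cite: HofmeisterEtAl2002, §3 (Ind-Clauses-Assign)] -/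
def initSel : List (List (ℕ × Bool)) → Asg × Asg × List Bool → Asg × Asg × List Bool
  | [], σ => σ
  | C :: cs, σ => initSel cs (selClause C σ)

/-- `initSel` over an append. [folklore] -/
theorem initSel_append_clauses : ∀ (cs₁ cs₂ : List (List (ℕ × Bool))) (σ : Asg × Asg × List Bool),
    initSel (cs₁ ++ cs₂) σ = initSel cs₂ (initSel cs₁ σ)
  | [], cs₂, σ => rfl
  | C :: cs₁, cs₂, σ => by rw [List.cons_append, initSel, initSel, initSel_append_clauses cs₁]

/-- The first component of the selection state is the greedy family. [folklore] -/
theorem initSel_fst : ∀ (cs : List (List (ℕ × Bool))) (σ : Asg × Asg × List Bool),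
    (initSel cs σ).1 = hAfter cs σ.1
  | [], σ => rfl
  | C :: cs, σ => by
    rw [initSel, initSel_fst cs, hAfter]
    unfold selClause
    split_ifs <;> rfl

/-- The selected clauses among `cs` from the selection state `Hl`, in order. [cite: HofmeisterEtAl2002, §2] -/
def selCls : List (List (ℕ × Bool)) → Asg → List (List (ℕ × Bool))
  | [], _ => []
  | C :: cs, Hl => if selC Hl C then C :: selCls cs (pushH C Hl) else selCls cs Hl

/-- The number of selected clauses. [folklore] -/
abbrev nSel (cs : List (List (ℕ × Bool))) (Hl : Asg) : ℕ := (selCls cs Hl).length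

/-- Selected clauses are clauses. [folklore] -/
theorem mem_of_mem_selCls : ∀ {cs : List (List (ℕ × Bool))} {Hl : Asg} {C : List (ℕ × Bool)},
    C ∈ selCls cs Hl → C ∈ cs
  | [], Hl, C, h => by simp [selCls] at h
  | C' :: cs, Hl, C, h => by
    unfold selCls at h
    split_ifs at h
    · rcases List.mem_cons.1 h with rfl | h
      · exact List.mem_cons_self
      · exact List.mem_cons_of_mem _ (mem_of_mem_selCls h)
    · exact List.mem_cons_of_mem _ (mem_of_mem_selCls h)

/-- Selected clauses have exactly `4` literals. [folklore] -/
theorem length_of_mem_selCls : ∀ {cs : List (List (ℕ × Bool))} {Hl : Asg} {C : List (ℕ × Bool)},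
    C ∈ selCls cs Hl → C.length = 4
  | [], Hl, C, h => by simp [selCls] at h
  | C' :: cs, Hl, C, h => by
    unfold selCls at h
    split_ifs at h with hs
    · rcases List.mem_cons.1 h with rfl | h
      · unfold selC at hs; simpa using (Bool.and_eq_true_iff.1 hs).1
      · exact length_of_mem_selCls h
    · exact length_of_mem_selCls h

/-- **The greedy family as a list**: the variables of the selected clauses, reversed, on top of the
initial state. [folklore] -/
theorem hAfter_eq : ∀ (cs : List (List (ℕ × Bool))) (Hl : Asg),
    hAfter cs Hl = ((selCls cs Hl).flatMap fun C => C.map fun l => (l.1, false)).reverse ++ Hl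
  | [], Hl => by simp [hAfter, selCls]
  | C :: cs, Hl => by
    rw [hAfter, selCls]
    split_ifs with hs
    · rw [hAfter_eq cs, pushH_eq, List.flatMap_cons, List.reverse_append, List.append_assoc]
    · exact hAfter_eq cs Hl

/-- The variables selected after `cs`: those selected before, and those of the selected clauses.
[folklore] -/
theorem memV_hAfter (cs : List (List (ℕ × Bool))) (Hl : Asg) (x : ℕ) :
    memV (hAfter cs Hl) x = (memV Hl x || (selCls cs Hl).any fun C => C.any fun l => l.1 == x) := by
  rw [hAfter_eq, memV_append, Bool.or_comm]
  congr 1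
  rw [Bool.eq_iff_iff, memV_eq_true_iff, List.any_eq_true]
  simp only [List.map_reverse, List.mem_reverse, List.map_flatMap, List.mem_flatMap, List.map_map, List.mem_map,
    Function.comp, List.any_eq_true, beq_iff_eq]

/-- **The selected clauses are variable-disjoint from the earlier state and from each other.**
[cite: HofmeisterEtAl2002, §2 (independent clauses: no variable in common)] -/
theorem selCls_disjoint : ∀ (cs : List (List (ℕ × Bool))) (Hl : Asg),
    (∀ C ∈ selCls cs Hl, ∀ l ∈ C, memV Hl l.1 = false) ∧
      (selCls cs Hl).Pairwise fun C D => ∀ l ∈ C, ∀ m ∈ D, l.1 ≠ m.1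
  | [], Hl => by simp [selCls]
  | C :: cs, Hl => by
    rw [selCls]
    split_ifs with hs
    · obtain ⟨h1, h2⟩ := selCls_disjoint cs (pushH C Hl)
      have hC : ∀ l ∈ C, memV Hl l.1 = false := by
        unfold selC at hs
        have := (Bool.and_eq_true_iff.1 hs).2
        rw [List.all_eq_true] at this
        intro l hl; simpa using this l hl
      refine ⟨fun D hD => ?_, List.pairwise_cons.2 ⟨fun D hD l hl m hm hlm => ?_, h2⟩⟩
      · rcases List.mem_cons.1 hD with rfl | hD
        · exact hC
        · intro l hl
          have := h1 D hD l hl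
          rw [memV_pushH] at this
          exact (Bool.or_eq_false_iff.1 this).1
      · have := h1 D hD m hm
        rw [memV_pushH, Bool.or_eq_false_iff] at this
        have := List.any_eq_false.1 this.2 l hl
        simp [hlm] at this
    · obtain ⟨h1, h2⟩ := selCls_disjoint cs Hl
      exact ⟨h1, h2⟩

/-- Lay the selected clauses from the coins: `10` coins per clause, in order. [folklore] -/
def laySel : List (List (ℕ × Bool)) → List Bool → Asg → Asg
  | [], _, L => L
  | C :: Cs, w, L => laySel Cs (w.drop 10) (pushSel C (tbl (bval (w.take 10))) L)

/-- **The selection pass, explicitly**: on `10 · nSel` coins followed by anything it lays `laySel` of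
the selected clauses and leaves the rest unread. [folklore] -/
theorem initSel_eq : ∀ (cs : List (List (ℕ × Bool))) (Hl L : Asg) (w r : List Bool),
    w.length = 10 * nSel cs Hl → initSel cs (Hl, L, w ++ r) = (hAfter cs Hl, laySel (selCls cs Hl) w L, r)
  | [], Hl, L, w, r, hw => by
    simp only [nSel, selCls, List.length_nil, Nat.mul_zero, List.length_eq_zero_iff] at hw
    subst hw; rfl
  | C :: cs, Hl, L, w, r, hw => by
    rw [initSel, hAfter, selCls]
    unfold selClause
    revert hw
    rw [nSel, selCls]
    cases h : selC Hl C with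
    | true =>
      intro hw
      simp only [ite_true, List.length_cons] at hw ⊢
      have ht : (w.take 10).length = 10 := by rw [List.length_take]; omega
      have hd : (w.drop 10).length = 10 * nSel cs (pushH C Hl) := by rw [List.length_drop, hw, nSel]; omega
      have h1 : readU 10 (w ++ r) = (bval (w.take 10), w.drop 10 ++ r) := by
        have := readU_append' (w.take 10) (w.drop 10 ++ r) ht
        rwa [← List.append_assoc, List.take_append_drop] at this
      simp only [h1, laySel]
      exact initSel_eq cs _ _ _ r hd
    | false =>
      intro hw
      simp only [Bool.false_eq_true, ite_false] at hw ⊢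
      exact initSel_eq cs Hl L w r hw

/-- `initSel` consumes `10` coins per selected clause (while available). [folklore] -/
theorem length_initSel : ∀ (cs : List (List (ℕ × Bool))) (σ : Asg × Asg × List Bool),
    (initSel cs σ).2.2.length = σ.2.2.length - 10 * nSel cs σ.1
  | [], σ => by simp [initSel, nSel, selCls]
  | C :: cs, σ => by
    rw [initSel, length_initSel cs]
    simp only [nSel, selCls]
    unfold selClause
    split_ifs with h
    · simp only [length_readU, List.length_cons]; omega
    · simp

/-! ### The uniform initialisation of the remaining variables -/

/-- One occurrence in the conditional pass: an unassigned variable takes one coin. [cite: HofmeisterEtAl2002, §3 (the remaining variables are set uniformly at random)] -/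
def condLit (l : ℕ × Bool) (τ : Asg × List Bool) : Asg × List Bool :=
  if memV τ.1 l.1 then τ else ((l.1, (popD τ.2).1) :: τ.1, (popD τ.2).2)

/-- **The conditional pass** over the occurrences. [cite: HofmeisterEtAl2002, §3] -/
def initCond : List (ℕ × Bool) → Asg × List Bool → Asg × List Bool
  | [], τ => τ
  | l :: ls, τ => initCond ls (condLit l τ)

/-- `initCond` over an append. [folklore] -/
theorem initCond_append_lits : ∀ (ls₁ ls₂ : List (ℕ × Bool)) (τ : Asg × List Bool),
    initCond (ls₁ ++ ls₂) τ = initCond ls₂ (initCond ls₁ τ)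
  | [], ls₂, τ => rfl
  | l :: ls₁, ls₂, τ => by rw [List.cons_append, initCond, initCond, initCond_append_lits ls₁]

/-- The variables taking a coin in the conditional pass: the occurrences of variables not assigned
before (by `L` or by an earlier occurrence), in order. [folklore] -/
def newVars : List (ℕ × Bool) → Asg → List ℕ
  | [], _ => []
  | l :: ls, L => if memV L l.1 then newVars ls L else l.1 :: newVars ls ((l.1, false) :: L)

/-- The number of coins of the conditional pass. [folklore] -/
abbrev nCond (ls : List (ℕ × Bool)) (L : Asg) : ℕ := (newVars ls L).length

/-- `newVars` only depends on which variables are assigned. [folklore] -/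
theorem newVars_congr : ∀ (ls : List (ℕ × Bool)) {L L' : Asg}, (∀ x, memV L x = memV L' x) →
    newVars ls L = newVars ls L'
  | [], L, L', _ => rfl
  | l :: ls, L, L', h => by
    rw [newVars, newVars, h l.1]
    split_ifs
    · exact newVars_congr ls h
    · rw [newVars_congr ls (L := (l.1, false) :: L) (L' := (l.1, false) :: L') fun x => by
        rw [memV_cons, memV_cons, h x]]

/-- **The new variables**: a variable is new iff it occurs and was not assigned; the list has no
duplicates. [folklore] -/
theorem mem_newVars_iff : ∀ (ls : List (ℕ × Bool)) (L : Asg) (x : ℕ),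
    x ∈ newVars ls L ↔ x ∈ ls.map Prod.fst ∧ memV L x = false
  | [], L, x => by simp [newVars]
  | l :: ls, L, x => by
    rw [newVars]
    split_ifs with h
    · rw [mem_newVars_iff ls L x, List.map_cons, List.mem_cons]
      constructor
      · rintro ⟨h1, h2⟩; exact ⟨Or.inr h1, h2⟩
      · rintro ⟨h1 | h1, h2⟩
        · rw [h1, h] at h2; exact absurd h2 (by simp)
        · exact ⟨h1, h2⟩
    · rw [List.mem_cons, mem_newVars_iff ls _ x, List.map_cons, List.mem_cons, memV_cons, Bool.or_eq_false_iff]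
      constructor
      · rintro (rfl | ⟨h1, h2, h3⟩)
        · exact ⟨Or.inl rfl, by simpa using h⟩
        · exact ⟨Or.inr h1, h3⟩
      · rintro ⟨h1 | h1, h2⟩
        · exact Or.inl h1
        · by_cases hx : x = l.1
          · exact Or.inl hx
          · exact Or.inr ⟨h1, beq_false_of_ne fun h' => hx h'.symm, h2⟩

/-- The new variables are pairwise distinct. [folklore] -/
theorem nodup_newVars : ∀ (ls : List (ℕ × Bool)) (L : Asg), (newVars ls L).Nodup
  | [], L => by simp [newVars]
  | l :: ls, L => by
    rw [newVars]
    split_ifs with h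
    · exact nodup_newVars ls L
    · refine List.nodup_cons.2 ⟨fun hx => ?_, nodup_newVars ls _⟩
      have := ((mem_newVars_iff ls _ _).1 hx).2
      simp at this

/-- **The conditional pass, explicitly**: on `nCond` coins followed by anything it lays the new
variables zipped with the coins (`SchoeningCoin.Lxs`) on top of `L` and leaves the rest unread.
[folklore] -/
theorem initCond_eq : ∀ (ls : List (ℕ × Bool)) (L : Asg) (w r : List Bool), w.length = nCond ls L →
    initCond ls (L, w ++ r) = (Lxs (newVars ls L) w ++ L, r)
  | [], L, w, r, hw => by
    simp only [nCond, newVars, List.length_nil, List.length_eq_zero_iff] at hw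
    subst hw; simp [initCond, Lxs]
  | l :: ls, L, w, r, hw => by
    rw [initCond]
    revert hw
    rw [nCond, newVars]
    unfold condLit
    cases h : memV L l.1 with
    | true =>
      intro hw
      simp only [ite_true] at hw ⊢
      exact initCond_eq ls L w r hw
    | false =>
      intro hw
      obtain ⟨b, w', rfl⟩ : ∃ b w', w = b :: w' := by
        cases w with
        | nil => simp at hw
        | cons b w' => exact ⟨b, w', rfl⟩
      simp only [Bool.false_eq_true, ite_false, List.cons_append, popD_cons]
      have hw' : w'.length = nCond ls ((l.1, b) :: L) := by
        rw [nCond, newVars_congr ls (L := (l.1, b) :: L) (L' := (l.1, false) :: L) (fun x => by simp)]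
        simpa using hw
      rw [initCond_eq ls _ w' r hw', newVars_congr ls (L := (l.1, false) :: L) (L' := (l.1, b) :: L)
        (fun x => by simp)]
      simp [Lxs]

/-- `initCond` consumes `nCond` coins (while available). [folklore] -/
theorem length_initCond : ∀ (ls : List (ℕ × Bool)) (τ : Asg × List Bool),
    (initCond ls τ).2.length = τ.2.length - nCond ls τ.1
  | [], τ => by simp [initCond, nCond, newVars]
  | l :: ls, τ => by
    rw [initCond, length_initCond ls]
    simp only [nCond, newVars]
    unfold condLit
    split_ifs with h
    · simp
    · simp only [length_popD, List.length_cons]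
      rw [newVars_congr ls (L := (l.1, (popD τ.2).1) :: τ.1) (L' := (l.1, false) :: τ.1) (fun x => by simp)]
      omega

/-! ### The frozen walk -/

/-- The *active* literals of a clause: those whose variable is not selected (`Hl`). [folklore] -/
def actF (Hl : Asg) (c : List (ℕ × Bool)) : List (ℕ × Bool) := c.filter fun l => !memV Hl l.1

/-- One step of the frozen walk with the number `u`: on the first violated clause `C`, flip the
variable of the `u`-th *active* literal of `C` (in order; nothing if `C` has at most `u` active
literals) — the selected variables are never flipped. [cite: HofmeisterEtAl2002, §3 (the variables of the independent clauses keep their initial values); SchoeningFOCS1999, Theorem (the walk)] -/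
def stepF (φ : KCNF k) (Hl L : Asg) (u : ℕ) : Asg :=
  match viol φ L.val with
  | none => L
  | some c => if h : u < (actF Hl c).length then flipVar L ((actF Hl c).get ⟨u, h⟩).1 else L

/-- A satisfied assignment is not moved by the frozen walk. [folklore] -/
theorem stepF_of_eval {φ : KCNF k} {Hl L : Asg} (h : φ.eval L.val = true) (u : ℕ) : stepF φ Hl L u = L := by
  unfold stepF
  rw [(eval_eq_true_iff_viol_eq_none φ _).1 h]

/-- **The frozen walk** of at most `S` steps, `d` coins per step, returning the final literal list,
the success bit and the unread coins. [cite: SchoeningFOCS1999, Theorem (the walk); HofmeisterEtAl2002, §3] -/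
def walkF (φ : KCNF k) (Hl : Asg) (d : ℕ) : ℕ → Asg → List Bool → Asg × Bool × List Bool
  | 0, L, r => (L, false, r)
  | s + 1, L, r =>
    if φ.eval L.val then (L, true, r) else walkF φ Hl d s (stepF φ Hl L (readU d r).1) (readU d r).2

/-- `walkF` on a satisfied list. [folklore] -/
theorem walkF_succ_of_eval {φ : KCNF k} {Hl : Asg} {d s : ℕ} {L : Asg} {r : List Bool}
    (h : φ.eval L.val = true) : walkF φ Hl d (s + 1) L r = (L, true, r) := by
  rw [walkF, if_pos h]

/-- `walkF` on an unsatisfied list. [folklore] -/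
theorem walkF_succ_of_not_eval {φ : KCNF k} {Hl : Asg} {d s : ℕ} {L : Asg} {r : List Bool}
    (h : φ.eval L.val = false) :
    walkF φ Hl d (s + 1) L r = walkF φ Hl d s (stepF φ Hl L (readU d r).1) (readU d r).2 := by
  rw [walkF]
  simp [h]

/-- The frozen walk consumes coins from the front. [folklore] -/
theorem length_walkF (φ : KCNF k) (Hl : Asg) (d : ℕ) : ∀ (s : ℕ) (L : Asg) (r : List Bool),
    (walkF φ Hl d s L r).2.2.length ≤ r.length
  | 0, L, r => le_rfl
  | s + 1, L, r => by
    unfold walkF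
    split_ifs
    · exact le_rfl
    · exact (length_walkF φ Hl d s _ _).trans (by rw [length_readU]; omega)

/-- A successful frozen walk has found a satisfying assignment. [folklore] -/
theorem satisfiable_of_walkF {φ : KCNF k} {Hl : Asg} {d : ℕ} :
    ∀ {s : ℕ} {L : Asg} {r : List Bool}, (walkF φ Hl d s L r).2.1 = true → φ.Satisfiable
  | 0, L, r, h => by simp [walkF] at h
  | s + 1, L, r, h => by
    unfold walkF at h
    split_ifs at h with he
    · exact satisfiable_of_eval he
    · exact satisfiable_of_walkF h

/-- **Locality of the frozen walk.** [folklore] -/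
theorem walkF_append (φ : KCNF k) (Hl : Asg) (d : ℕ) : ∀ (S : ℕ) (L : Asg) (w r : List Bool),
    w.length = S * d →
    (walkF φ Hl d S L (w ++ r)).2.1 = (walkF φ Hl d S L w).2.1 ∧
      ((walkF φ Hl d S L w).2.1 = false → (walkF φ Hl d S L (w ++ r)).2.2 = r)
  | 0, L, w, r, hw => by
    simp only [Nat.zero_mul, List.length_eq_zero_iff] at hw
    subst hw
    simp [walkF]
  | S + 1, L, w, r, hw => by
    have ht : (w.take d).length = d := by rw [List.length_take]; rw [Nat.succ_mul] at hw; omega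
    have hd : (w.drop d).length = S * d := by rw [List.length_drop, hw, Nat.succ_mul]; omega
    have h1 : readU d (w ++ r) = (bval (w.take d), w.drop d ++ r) := by
      have := readU_append' (w.take d) (w.drop d ++ r) ht
      rwa [← List.append_assoc, List.take_append_drop] at this
    have h2 : readU d w = (bval (w.take d), w.drop d) := by
      have := readU_append' (w.take d) (w.drop d) ht
      rwa [List.take_append_drop] at this
    simp only [walkF, h1, h2]
    split_ifs with he
    · simp
    · exact walkF_append φ Hl d S _ _ r hd

/-! ### One ticket, and the whole algorithm -/

/-- The occurrences of literals of `φ`, in reading order. [folklore] -/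
def occL (φ : KCNF k) : List (ℕ × Bool) := φ.clauses.flatMap id

/-- The variables of the literal occurrences are the occurrences of `SchoeningCoinAlgorithm.lean`.
[folklore] -/
theorem map_fst_occL (φ : KCNF k) : (occL φ).map Prod.fst = occs φ := by
  unfold occL occs
  induction φ.clauses with
  | nil => rfl
  | cons c cs ih => simp only [List.flatMap_cons, List.map_append, id, ih]

/-- **The whole initialisation** from the coins `r`: the selected variables, the initial literal list,
the unread coins. [cite: HofmeisterEtAl2002, §3 (Ind-Clauses-Assign followed by a uniform assignment of the other variables)] -/
def initAll (φ : KCNF k) (r : List Bool) : Asg × Asg × List Bool :=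
  ((initSel φ.clauses ([], [], r)).1,
    (initCond (occL φ) ((initSel φ.clauses ([], [], r)).2.1, (initSel φ.clauses ([], [], r)).2.2)).1,
    (initCond (occL φ) ((initSel φ.clauses ([], [], r)).2.1, (initSel φ.clauses ([], [], r)).2.2)).2)

/-- The literal list of the selected variables of `φ`. [folklore] -/
def hl (φ : KCNF k) : Asg := hAfter φ.clauses []

/-- The first component of `initAll` is `hl`. [folklore] -/
theorem initAll_fst (φ : KCNF k) (r : List Bool) : (initAll φ r).1 = hl φ := by
  unfold initAll hl; rw [initSel_fst]

/-- The assigned variables after `laySel` are those assigned before and those of the laid clauses.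
[folklore] -/
theorem memV_laySel : ∀ (Cs : List (List (ℕ × Bool))) (w : List Bool) (L : Asg) (x : ℕ),
    (∀ C ∈ Cs, C.length = 4) →
    memV (laySel Cs w L) x = (memV L x || Cs.any fun C => C.any fun l => l.1 == x)
  | [], w, L, x, _ => by simp [laySel]
  | C :: Cs, w, L, x, hlen => by
    rw [laySel, memV_laySel Cs _ _ x (fun D hD => hlen D (List.mem_cons_of_mem _ hD)),
      memV_pushSel _ _ _ (by rw [length_tbl, hlen C List.mem_cons_self]), List.any_cons, Bool.or_assoc]

/-- The assigned variables after `laySel` of the selected clauses are those of `hAfter`. [folklore] -/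
theorem memV_laySel_selCls (cs : List (List (ℕ × Bool))) (Hl : Asg) (w : List Bool) (x : ℕ) :
    memV (laySel (selCls cs Hl) w []) x = (selCls cs Hl).any fun C => C.any fun l => l.1 == x := by
  rw [memV_laySel _ _ _ _ fun C hC => length_of_mem_selCls hC, memV_nil, Bool.false_or]

/-- The variables taking a coin in the conditional pass of `φ`: the occurring variables outside the
greedy family, in order of first occurrence. [folklore] -/
def cvars (φ : KCNF k) : List ℕ := newVars (occL φ) (hl φ)

/-- The number of coins of the initialisation: `10` per selected clause, one per remaining occurring
variable. [folklore] -/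
def nInit (φ : KCNF k) : ℕ := 10 * nSel φ.clauses [] + (cvars φ).length

/-- **The initialisation, explicitly**: on `nInit` coins `w₁ ++ w₂` (`|w₁| = 10 · nSel`) followed by
anything, the selected variables are `hl φ`, the literal list is the new variables zipped with `w₂`
on top of `laySel` of the selected clauses on `w₁`, and the rest is unread. [folklore] -/
theorem initAll_eq (φ : KCNF k) (w₁ w₂ r : List Bool) (hw₁ : w₁.length = 10 * nSel φ.clauses [])
    (hw₂ : w₂.length = (cvars φ).length) :
    initAll φ (w₁ ++ w₂ ++ r) = (hl φ, Lxs (cvars φ) w₂ ++ laySel (selCls φ.clauses []) w₁ [], r) := by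
  unfold initAll
  rw [List.append_assoc, initSel_eq φ.clauses [] [] w₁ (w₂ ++ r) hw₁]
  simp only
  have hcv : newVars (occL φ) (laySel (selCls φ.clauses []) w₁ []) = cvars φ := by
    unfold cvars hl
    exact newVars_congr _ fun x => by rw [memV_laySel_selCls, memV_hAfter, memV_nil, Bool.false_or]
  rw [initCond_eq _ _ _ r (by rw [nCond, hcv]; exact hw₂), hcv]
  rfl

/-- **Locality of the initialisation**: on `nInit` coins followed by anything, the same lists are laid
and the rest is unread. [folklore] -/
theorem initAll_append (φ : KCNF k) (w r : List Bool) (hw : w.length = nInit φ) :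
    initAll φ (w ++ r) = ((initAll φ w).1, (initAll φ w).2.1, r) := by
  unfold nInit at hw
  set a := 10 * nSel φ.clauses [] with ha
  have ht : (w.take a).length = a := by rw [List.length_take]; omega
  have hd : (w.drop a).length = (cvars φ).length := by rw [List.length_drop, hw]; omega
  have h1 := initAll_eq φ (w.take a) (w.drop a) r ht hd
  have h2 := initAll_eq φ (w.take a) (w.drop a) [] ht hd
  rw [List.take_append_drop] at h1
  rw [List.append_nil, List.take_append_drop] at h2
  rw [h1, h2]

/-- **One ticket**: the biased initialisation, Schöning's walk of `S` steps with `d` coins per step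
(`SchoeningCoin.walk`), and — if it failed — the frozen walk of `S` steps from the same initial
assignment. Returns the success bit and the unread coins. [cite: HofmeisterEtAl2002, §3–§4 (the combination of the procedures); SchoeningFOCS1999, Theorem] -/
def ticket (φ : KCNF k) (d S : ℕ) (r : List Bool) : Bool × List Bool :=
  if (walk φ d S (initAll φ r).2.1 (initAll φ r).2.2).1 then
    (true, (walk φ d S (initAll φ r).2.1 (initAll φ r).2.2).2)
  else (walkF φ (initAll φ r).1 d S (initAll φ r).2.1 (walk φ d S (initAll φ r).2.1 (initAll φ r).2.2).2).2

/-- The initialisation consumes coins from the front. [folklore] -/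
theorem length_initAll (φ : KCNF k) (r : List Bool) : (initAll φ r).2.2.length ≤ r.length := by
  unfold initAll
  simp only [length_initCond, length_initSel]
  omega

/-- A ticket consumes coins from the front. [folklore] -/
theorem length_ticket (φ : KCNF k) (d S : ℕ) (r : List Bool) : (ticket φ d S r).2.length ≤ r.length := by
  unfold ticket
  have h1 := length_initAll φ r
  have h2 := length_walk φ d S (initAll φ r).2.1 (initAll φ r).2.2
  split_ifs
  · exact h2.trans h1
  · exact ((length_walkF φ _ d S _ _).trans h2).trans h1

/-- A successful ticket has found a satisfying assignment. [folklore] -/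
theorem satisfiable_of_ticket {φ : KCNF k} {d S : ℕ} {r : List Bool} (h : (ticket φ d S r).1 = true) :
    φ.Satisfiable := by
  unfold ticket at h
  split_ifs at h with hw
  · exact satisfiable_of_walk hw
  · exact satisfiable_of_walkF h

/-- The number of coins of a failing ticket: the initialisation and two full walks. [folklore] -/
def cpt (φ : KCNF k) (d S : ℕ) : ℕ := nInit φ + S * d + S * d

/-- **Locality of a ticket**: on `cpt` coins followed by anything, a ticket has the same success bit
as on the first `cpt` coins, and if it fails it has consumed exactly them. [folklore] -/
theorem ticket_append (φ : KCNF k) (d S : ℕ) (w r : List Bool) (hw : w.length = cpt φ d S) :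
    (ticket φ d S (w ++ r)).1 = (ticket φ d S w).1 ∧
      ((ticket φ d S w).1 = false → (ticket φ d S (w ++ r)).2 = r) := by
  unfold cpt at hw
  set a := nInit φ with ha
  set w₁ := w.take a with hw₁
  set w₂ := (w.drop a).take (S * d) with hw₂
  set w₃ := (w.drop a).drop (S * d) with hw₃
  have h₁ : w₁.length = a := by rw [hw₁, List.length_take]; omega
  have h₂ : w₂.length = S * d := by rw [hw₂, List.length_take, List.length_drop]; omega
  have h₃ : w₃.length = S * d := by rw [hw₃, List.length_drop, List.length_drop]; omega
  have hw_eq : w = w₁ ++ (w₂ ++ w₃) := by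
    rw [hw₁, hw₂, hw₃, List.take_append_drop, List.take_append_drop]
  have hI1 : initAll φ (w ++ r) = ((initAll φ w₁).1, (initAll φ w₁).2.1, w₂ ++ (w₃ ++ r)) := by
    rw [hw_eq, List.append_assoc, List.append_assoc, initAll_append φ w₁ _ h₁]
  have hI2 : initAll φ w = ((initAll φ w₁).1, (initAll φ w₁).2.1, w₂ ++ w₃) := by
    rw [hw_eq, initAll_append φ w₁ _ h₁]
  set L₀ := (initAll φ w₁).2.1 with hL₀
  set H₀ := (initAll φ w₁).1 with hH₀
  obtain ⟨hB1, hB2⟩ := walk_append φ d S L₀ w₂ (w₃ ++ r) h₂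
  obtain ⟨hB1', hB2'⟩ := walk_append φ d S L₀ w₂ w₃ h₂
  unfold ticket
  rw [hI1, hI2]
  simp only
  rw [hB1, hB1']
  cases hb : (walk φ d S L₀ w₂).1
  · simp only [Bool.false_eq_true, ite_false]
    rw [hB2 hb, hB2' hb]
    obtain ⟨hA1, hA2⟩ := walkF_append φ H₀ d S L₀ w₃ r h₃
    refine ⟨hA1, fun hfail => hA2 ?_⟩
    exact hfail
  · simp

/-- **The algorithm on a coin string**, with fuel: pop one coin per ticket and run tickets until the
coins (or the fuel) are exhausted; accept iff some ticket succeeded. [folklore] -/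
def runFuel (φ : KCNF k) (d S : ℕ) : ℕ → List Bool → Bool
  | 0, _ => false
  | _ + 1, [] => false
  | n + 1, _ :: r => (ticket φ d S r).1 || runFuel φ d S n (ticket φ d S r).2

/-- With enough fuel, the fuel does not matter. [folklore] -/
theorem runFuel_eq_of_le (φ : KCNF k) (d S : ℕ) : ∀ (n m : ℕ) (r : List Bool), r.length ≤ n → n ≤ m →
    runFuel φ d S n r = runFuel φ d S m r
  | 0, m, r, hn, _ => by
    rw [List.eq_nil_of_length_eq_zero (Nat.le_zero.1 hn)]
    cases m <;> rfl
  | n + 1, 0, r, _, hm => by omega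
  | n + 1, m + 1, [], _, _ => rfl
  | n + 1, m + 1, b :: r, hn, hm => by
    simp only [runFuel]
    rw [runFuel_eq_of_le φ d S n m _ ?_ (by omega)]
    have := length_ticket φ d S r
    simp at hn; omega

/-- **The biased-start algorithm for 4-SAT on a coin string** (applied by the machine to `dedup φ`
with `d = 3`, `S = sOf (dedup φ)`): one ticket per remaining coin. [cite: HofmeisterEtAl2002, §3–§4; SchoeningFOCS1999, Theorem] -/
def run4 (φ : KCNF k) (d S : ℕ) (r : List Bool) : Bool := runFuel φ d S r.length r

/-- `run4` on the empty string. [folklore] -/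
@[simp] theorem run4_nil (φ : KCNF k) (d S : ℕ) : run4 φ d S [] = false := rfl

/-- `run4` unrolled once: the recursion of the machine's main loop. [folklore] -/
theorem run4_cons (φ : KCNF k) (d S : ℕ) (b : Bool) (r : List Bool) :
    run4 φ d S (b :: r) = ((ticket φ d S r).1 || run4 φ d S (ticket φ d S r).2) := by
  unfold run4
  simp only [List.length_cons, runFuel]
  rw [← runFuel_eq_of_le φ d S _ r.length _ le_rfl (length_ticket φ d S r)]

/-- **One-sided error**: an unsatisfiable formula is always rejected. [cite: SchoeningFOCS1999, Theorem (proof: an unsatisfiable formula is never accepted)] -/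
theorem run4_eq_false_of_not_satisfiable {φ : KCNF k} (h : ¬ φ.Satisfiable) (d S : ℕ) :
    ∀ r : List Bool, run4 φ d S r = false := by
  suffices H : ∀ (n : ℕ) (r : List Bool), r.length ≤ n → run4 φ d S r = false from fun r => H _ r le_rfl
  intro n
  induction n with
  | zero => intro r hr; rw [List.eq_nil_of_length_eq_zero (Nat.le_zero.1 hr), run4_nil]
  | succ n ih =>
    intro r hr
    cases r with
    | nil => rw [run4_nil]
    | cons b r =>
      rw [run4_cons]
      have h1 : (ticket φ d S r).1 = false := by
        cases hb : (ticket φ d S r).1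
        · rfl
        · exact absurd (satisfiable_of_ticket hb) h
      rw [h1, Bool.false_or]
      refine ih _ ?_
      have := length_ticket φ d S r
      simp only [List.length_cons] at hr
      omega

end Literature.Computability.FineGrained.SchoeningFour
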